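import Literature.Combinatorics.SimpleGraph.TreeDecomposition
import Mathlib.Combinatorics.SimpleGraph.LineGraph
import Mathlib.Combinatorics.SimpleGraph.Finite
import Mathlib.Combinatorics.SimpleGraph.Connectivity.Subgraph
import HarnessLib

/-!
# Treewidth of the line graph

Markov–Shi (*Simulating quantum computation by contracting tensor networks*, Lemma 4.4):
"For any graph `G` of maximum degree `Δ(G)`, `(tw(G) - 1)/2 ≤ tw(G*) ≤ Δ(G)(tw(G) + 1) - 1`",
where `G*` is the line graph. This file proves the **upper bound** (the direction used in their
Theorem 4.6: the cost of contracting a tensor network on `G` is `exp(O(tw(G*)))`, and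
`tw(G*) = O(tw(G))` for bounded degree), with the printed proof: "From a tree decomposition `𝒯`
of `G` of width `d` we obtain a tree decomposition `𝒯*` of `G*` of width `(d+1)·Δ(G) - 1` by
replacing each vertex `v ∈ V(G)` with all edges `e` incident to `v`."

* `TreeDecomposition.lineGraph D` — the decomposition `𝒯*` of Mathlib's `G.lineGraph` (same
  tree; the bag at `t` is the set of edges meeting `D.bag t`), with (T2) because two adjacent
  edges share a vertex lying in some bag, and (T3) because the bags containing the edge `uv` are
  those containing `u` or `v`, two subtrees meeting at a bag containing both
  (`SimpleGraph.induce_union_connected`);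
* `TreeDecomposition.card_bag_lineGraph_le` — `|B*_t| ≤ Δ(G)·|B_t|`;
* `treewidth_lineGraph_le` — `tw(G*) ≤ Δ(G)(tw(G) + 1) - 1`.

The lower bound `(tw(G) - 1)/2 ≤ tw(G*)` (replace every edge by its two ends) is not needed for
the simulation theorem and is not vendored here.

## References

* [MarkovShi2008] I. L. Markov, Y. Shi, SIAM J. Comput. 38 (2008) 963–981
  (arXiv:quant-ph/0511069), §4, Lemma 4.4 and its proof (p. 9 of the arXiv version). Read via
  `lit read paper:arxiv-quant-ph_0511069`.
-/

namespace Literature.Combinatorics.SimpleGraph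

open _root_.SimpleGraph

variable {V : Type*} [Fintype V] [DecidableEq V] (G : _root_.SimpleGraph V) [DecidableRel G.Adj]

namespace TreeDecomposition

variable {ι : Type*}

/-- **The line-graph decomposition `𝒯*`** of a tree decomposition `𝒯` of `G` (Markov–Shi,
proof of Lemma 4.4): the same tree, the bag at `t` being the edges of `G` meeting the bag
`B_t` ("replacing each vertex `v` with all edges `e` incident to `v`").
[cite: MarkovShi2008, §4 (Lemma 4.4, proof)] -/
def lineGraph (D : TreeDecomposition G ι) : TreeDecomposition G.lineGraph ι where
  tree := D.tree
  isTree := D.isTree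
  bag t := Finset.univ.filter fun e : G.edgeSet => ∃ v ∈ D.bag t, v ∈ (e : Sym2 V)
  exists_mem_bag_of_adj := by
    intro e₁ e₂ h
    obtain ⟨-, v, hv₁, hv₂⟩ := lineGraph_adj_iff_exists.1 h
    obtain ⟨t, ht⟩ := D.exists_mem_bag v
    refine ⟨t, ?_, ?_⟩
    · simp only [Finset.mem_filter, Finset.mem_univ, true_and]
      exact ⟨v, ht, hv₁⟩
    · simp only [Finset.mem_filter, Finset.mem_univ, true_and]
      exact ⟨v, ht, hv₂⟩
  connected_induce := by
    rintro ⟨e, he⟩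
    induction e using Sym2.ind with
    | _ u v =>
      have huv : G.Adj u v := he
      have hset : {t | (⟨s(u, v), he⟩ : G.edgeSet) ∈
            Finset.univ.filter fun e : G.edgeSet => ∃ x ∈ D.bag t, x ∈ (e : Sym2 V)} =
          {t | u ∈ D.bag t} ∪ {t | v ∈ D.bag t} := by
        ext t
        simp only [Finset.mem_filter, Finset.mem_univ, true_and, Sym2.mem_iff, Set.mem_setOf_eq,
          Set.mem_union]
        constructor
        · rintro ⟨x, hx, rfl | rfl⟩
          · exact Or.inl hx
          · exact Or.inr hx
        · rintro (h | h)
          · exact ⟨u, h, Or.inl rfl⟩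
          · exact ⟨v, h, Or.inr rfl⟩
      rw [hset]
      obtain ⟨t, htu, htv⟩ := D.exists_mem_bag_of_adj huv
      exact induce_union_connected (D.connected_induce u).preconnected
        (D.connected_induce v).preconnected ⟨t, htu, htv⟩

/-- The bags of `𝒯*` (definitional). [cite: MarkovShi2008, §4 (Lemma 4.4, proof)] -/
theorem mem_bag_lineGraph (D : TreeDecomposition G ι) (t : ι) (e : G.edgeSet) :
    e ∈ (D.lineGraph G).bag t ↔ ∃ v ∈ D.bag t, v ∈ (e : Sym2 V) := by
  simp [TreeDecomposition.lineGraph]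

/-- `|B*_t| ≤ Δ(G)·|B_t|`: every edge meeting the bag is incident to one of its `|B_t|`
vertices, each of degree `≤ Δ(G)`. [cite: MarkovShi2008, §4 (Lemma 4.4, proof)] -/
theorem card_bag_lineGraph_le (D : TreeDecomposition G ι) (t : ι) :
    ((D.lineGraph G).bag t).card ≤ G.maxDegree * (D.bag t).card := by
  calc ((D.lineGraph G).bag t).card
      = (((D.lineGraph G).bag t).map (Function.Embedding.subtype _)).card :=
        (Finset.card_map _).symm
    _ ≤ ((D.bag t).biUnion fun v => G.incidenceFinset v).card := by
        refine Finset.card_le_card fun e he => ?_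
        simp only [Finset.mem_map, Function.Embedding.coe_subtype] at he
        obtain ⟨⟨e, heE⟩, hmem, rfl⟩ := he
        obtain ⟨v, hv, hve⟩ := (mem_bag_lineGraph G D t _).1 hmem
        exact Finset.mem_biUnion.2 ⟨v, hv, (G.mem_incidenceFinset v e).2 ⟨heE, hve⟩⟩
    _ ≤ ∑ v ∈ D.bag t, (G.incidenceFinset v).card := Finset.card_biUnion_le
    _ ≤ ∑ v ∈ D.bag t, G.maxDegree := Finset.sum_le_sum fun v _ => by
        rw [card_incidenceFinset_eq_degree]
        exact G.degree_le_maxDegree v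
    _ = G.maxDegree * (D.bag t).card := by rw [Finset.sum_const, smul_eq_mul, Nat.mul_comm]

end TreeDecomposition

/-- **Markov–Shi 2008, Lemma 4.4 (upper bound): `tw(G*) ≤ Δ(G)·(tw(G) + 1) - 1`** for the line
graph `G*` of a finite simple graph `G` of maximum degree `Δ(G)`: take a tree decomposition of
`G` attaining the treewidth and pass to `TreeDecomposition.lineGraph`, whose bags have at most
`Δ(G)·(tw(G) + 1)` edges. (Natural-number subtraction: for an edgeless `G` both sides are `0`.)
[cite: MarkovShi2008, §4 (Lemma 4.4)] -/
theorem treewidth_lineGraph_le : treewidth G.lineGraph ≤ G.maxDegree * (treewidth G + 1) - 1 := by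
  obtain ⟨k, D, hD⟩ := exists_width_eq_treewidth G
  refine (treewidth_le_width (D.lineGraph G)).trans ?_
  have h : ∀ t, ((D.lineGraph G).bag t).card ≤ G.maxDegree * (D.width + 1) := fun t =>
    (D.card_bag_lineGraph_le G t).trans (Nat.mul_le_mul_left _ (D.card_bag_le_width_add_one t))
  rw [← hD]
  exact TreeDecomposition.width_le _ fun t => (h t).trans (by omega)

end Literature.Combinatorics.SimpleGraph
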